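import Summits.QuantumFields.BalabanUV.Beta.D1BFx.MomentTransferCross
import Summits.QuantumFields.BalabanUV.Beta.D1BFx.ReducedKernelSandwichLeg
import Summits.QuantumFields.BalabanUV.Beta.D1BFx.Assembly

/-!
# `BalabanUV.Beta.D1BFx.MomentTransferDefect` — road «BF-x» for binder row D1, re-cut slot (K), row (K7) «TRANSFER-Δ» (part 2, road level):
# SLOT (F) FOR A T7-TYPE PIECE WITHOUT WARD ROWS, WITHOUT PARITY, WITHOUT TABLE SYMMETRY —
# `secondMoment (TOfLeg n A S (tableRedF n Wf)) μ ν = Σ_b n⁻⁴·fullSum (w ↦ n⁻⁸·w_μw_ν·baseKer (fineHessA A S Wf μ ν) b w) + rowDefect n (fineHessA A S Wf) μ ν`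
# with `rowDefect` EXPLICIT (part 1's `crossK` in (1.22) currency), LINEAR in the fine kernel and `0` under the record's Ward rows + columns + (T1-avg)

HONEST DEPENDENCY (page 1, mandatory): continuum YM on T⁴ ⇐ BetaPertH ∧ nine spine estimates (0/9 proved); BetaPertH ⇐ (D1) ∧ (D4) ∧
CAP+tail; G-an2-4 gates asym, D1 and NE2/3/4.  HONEST FRAMING (cell contract, verbatim): «discharging `BetaPertH` makes Bałaban's UV
stability UNCONDITIONAL — a real constructive-QFT result; it is NOT the continuum limit and NOT the Clay problem.»  [folklore] bookkeeping composed
BY NAME from part 1 (`MomentTransferCross.bondSecondMomentP_solutionOp_four_cross`, `crossK_add`∕`_smul`∕`_eq_zero`), the A4-leg sandwich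
`ReducedKernelSandwichLeg.TOfLeg_tableRedF_eq_dressedEntryP` (+ `isBlockPeriodic_fineHessA`, `absMoment₂_baseKer_fineHessA`, `fineHessA_transpose`),
the parity lemma `MomentTransferParity.sum_firstMoment_baseKer_eq_zero_of_inversion` and the A7 junction `Assembly.avgM2_eq_sum_fullSum`; ONE
[our object] data def (`rowDefect`); nothing of the manuscripts under audit asserted or cited; no `Prop` fact minted; 0∕4 row-D1 binders; slot (K)
NOT closed; nothing of D1 ∕ BetaPertH discharged.  Value = the (F) row of the re-cut END `RoadEndBFxRouteT` (owner spec
`HOME/b2b-balaban-beta-d1-p2/K-END-RECUT-SPEC.md` §5 (K7), ruling ρ-g7-9): under (R2) only the gauge-invariant TOTAL of the one-shot Hessian has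
vanishing Ward rows (`hWardTot`), so (F) is applied PER PIECE with the defect displayed and `Σ_pieces ω·rowDefect(piece) = rowDefect(total)`
cancelled by `rowDefect_add`∕`rowDefect_smul` + `rowDefect_eq_zero(_of_rows)`; NOT summit progress; NOT continuum, NOT Clay.

CONTENT (all [folklore] theorems):
* §1 `rowDefect n K μ ν := n⁻⁸ · crossK n K μ ν μ ν`; `rowDefect_add`, `rowDefect_smul`, `rowDefect_eq_zero` (columns + rows + (T1-avg), the
  record's hypotheses), `rowDefect_eq_zero_of_rows` (rows of EVERY entry + transpose symmetry `K κ′λ′ s s′ = K λ′κ′ s′ s` + an affine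
  inversion covariance — the sockets every piece of record has).
* §2 ANY LEG `A` (`Spr A`, block covariant), `S` self-localised ∕ covariant, `Wf` bi-localised ∕ jointly covariant — NOTHING ELSE:
  `bondSecondMoment_TOfLeg_eq_avgM2_add_crossK`, `secondMoment_TOfLeg_eq_add`, **`secondMoment_TOfLeg_eq_avg_fullSum_add_rowDefect`** (the (K7)
  line verbatim, in the currency of `AssemblySlots.hF_TOfRed`); the junction `secondMoment_eq_avg_fullSum_add`.
* §3 the ghost leg `Ggh n a` (`0 < a`): `secondMoment_TOfGh_eq_avg_fullSum_add_rowDefect`.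
* §4 CONSISTENCY (an `example`): the record's `ReducedKernelSandwichLeg.bondSecondMoment_TOfLeg_eq_avgM2` re-derived from §2 + `crossK_eq_zero`.
-/

namespace Summit.QuantumFields.BalabanUV.Beta.D1BFx.MomentTransferDefect

open Finset Filter Topology
open scoped BigOperators
open Literature.MathematicalPhysics.QuantumFieldTheory.Balaban1983to89
open Literature.MathematicalPhysics.QuantumFieldTheory.Balaban1983to89.Beta
open WindowIdentification (fullSum psum)
open DyadicShell (Pt toReal)
open ExpKernelCalculus (Site MKer BiLoc shiftK)
open DecimatedMomentSummable (AbsMoment₂)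
open DressedMomentNormalisation (resSite)
open MinimiserIdentityForm (wK)
open Summit.QuantumFields.BalabanUV.Beta.TameKernelCalculus (Spr)
open Summit.QuantumFields.BalabanUV.Beta.D1BFx.MomentTransferPeriodic (Ker₂ IsBlockPeriodic baseKer)
open Summit.QuantumFields.BalabanUV.Beta.D1BFx.MomentTransferPeriodicSum (periodicMajorant absMoment₂_periodicMajorant
  abs_baseKer_le_periodicMajorant)
open Summit.QuantumFields.BalabanUV.Beta.D1BFx.MomentTransferPeriodicEntry (EKer₂ dressedEntryP avgM2)
open Summit.QuantumFields.BalabanUV.Beta.D1BFx.MomentTransferParity (sum_firstMoment_baseKer_eq_zero_of_inversion)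
open Summit.QuantumFields.BalabanUV.Beta.D1BFx.MomentTransferCross (firstMom crossK crossK_add crossK_smul crossK_eq_zero
  bondSecondMomentP_solutionOp_four_cross)
open Summit.QuantumFields.BalabanUV.Beta.D1BFx.ReducedKernelF (TOfLeg TOfGh)
open Summit.QuantumFields.BalabanUV.Beta.D1BFx.ReducedTableF (tableRedF)
open Summit.QuantumFields.BalabanUV.Beta.D1BFx.ReducedKernelSandwichLeg (fineHessA isBlockPeriodic_fineHessA absMoment₂_baseKer_fineHessA
  TOfLeg_tableRedF_eq_dressedEntryP fineHessA_transpose)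
open Summit.QuantumFields.BalabanUV.Beta.D1BFx.GhostLeg (Ggh spr_Ggh shiftK_Ggh_neg)
open Summit.QuantumFields.BalabanUV.Beta.D1BFx.Assembly (avgM2_eq_sum_fullSum sum_image_resSite exists_tendsto_psum_weight_mul)

/-! ## §1 The row defect of a fine kernel in (1.22) currency -/

section Defect

variable (n : ℕ) [NeZero n]

/-- [our object] **THE ROW DEFECT** of a matrix fine two-point kernel `K` at block size `n`, in the currency of `B12Beta.secondMoment` of the
`ℋ`-dressed one-shot kernel: `rowDefect n K μ ν := n⁻⁸ · crossK n K μ ν μ ν` — part 1's explicit cross functional (column sums, first moments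
and row sums of every entry of `K` at the `n⁴` base points against the solution operator's coset data) read at the (1.22) entry ∕ weight `(μ,ν)`.
LINEAR in `K`; `0` under the record's Ward rows + columns + (T1-avg).  A DEFINITION; asserts nothing. -/
noncomputable def rowDefect (K : EKer₂ 4) (μ ν : Fin 4) : ℝ := ((n : ℝ) ^ 8)⁻¹ * crossK n K μ ν μ ν

/-- [folklore] **THE ROW DEFECT IS ADDITIVE** (entries block periodic with absolutely summable base-point kernels). -/
theorem rowDefect_add {K L : EKer₂ 4} (hK : ∀ c e, IsBlockPeriodic n (K c e)) (hL : ∀ c e, IsBlockPeriodic n (L c e))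
    (hKA : ∀ c e b, AbsMoment₂ (baseKer (K c e) b)) (hLA : ∀ c e b, AbsMoment₂ (baseKer (L c e) b)) (μ ν : Fin 4) :
    rowDefect n (K + L) μ ν = rowDefect n K μ ν + rowDefect n L μ ν := by
  rw [rowDefect, rowDefect, rowDefect, crossK_add n hK hL hKA hLA, mul_add]

/-- [folklore] **THE ROW DEFECT IS HOMOGENEOUS** (no hypothesis): piece weights pass through. -/
theorem rowDefect_smul (c : ℝ) (K : EKer₂ 4) (μ ν : Fin 4) : rowDefect n (c • K) μ ν = c * rowDefect n K μ ν := by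
  rw [rowDefect, rowDefect, crossK_smul]
  ring

/-- [folklore] **THE ROW DEFECT VANISHES UNDER THE RECORD'S HYPOTHESES** on the fine kernel: columns and rows of every entry summing to zero at
every point and base-point-summed first moments zero (EXACTLY the `hcol`∕`hrow`∕`hT1` consumed by the K-R5 ∕ A4 chain). -/
theorem rowDefect_eq_zero {K : EKer₂ 4} (hcol : ∀ c e b, HasSum (fun s => K c e s b) 0) (hrow : ∀ c e b, HasSum (K c e b) 0)
    (hT1 : ∀ c e (μ' : Fin 4), ∑ r : Fin 4 → Fin n, ∑' t, (t μ' : ℝ) * baseKer (K c e) (resSite r) t = 0) (μ ν : Fin 4) :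
    rowDefect n K μ ν = 0 := by
  rw [rowDefect, crossK_eq_zero n hcol hrow hT1, mul_zero]

/-- [folklore] **THE ROW DEFECT VANISHES FROM ROWS ALONE GIVEN THE PIECE'S SOCKETS**: every entry block periodic with absolutely summable
base-point kernels, TRANSPOSE SYMMETRY `K κ′λ′ s s′ = K λ′κ′ s′ s` (⇒ columns are rows of the transposed entry) and an affine INVERSION covariance
`K κ′λ′ (a₁ κ′ − s) (a₂ λ′ − s′) = K κ′λ′ s s′` (⇒ (T1-avg) by `MomentTransferParity`); then vanishing rows of every entry kill the defect. -/
theorem rowDefect_eq_zero_of_rows {K : EKer₂ 4} (hK : ∀ c e, IsBlockPeriodic n (K c e)) (hKA : ∀ c e b, AbsMoment₂ (baseKer (K c e) b))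
    (hKt : ∀ c e s s', K c e s s' = K e c s' s) {a₁ a₂ : Fin 4 → Site 4}
    (hinv : ∀ c e s s', K c e (a₁ c - s) (a₂ e - s') = K c e s s') (hrow : ∀ c e b, HasSum (K c e b) 0) (μ ν : Fin 4) :
    rowDefect n K μ ν = 0 := by
  have hN : 0 < n := Nat.pos_of_ne_zero (NeZero.ne n)
  have hcol : ∀ c e b, HasSum (fun s => K c e s b) 0 := fun c e b => (hrow e c b).congr_fun fun s => hKt c e s b
  have hcol' : ∀ c e b, HasSum (baseKer (K c e) b) 0 := fun c e b =>
    ((Equiv.hasSum_iff (Equiv.addLeft b)).mpr (hcol c e b)).congr_fun (fun _ => rfl)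
  have hT1 : ∀ c e (μ' : Fin 4), ∑ r : Fin 4 → Fin n, ∑' t, (t μ' : ℝ) * baseKer (K c e) (resSite r) t = 0 := fun c e μ' =>
    sum_firstMoment_baseKer_eq_zero_of_inversion hN (hK c e) (hinv c e) (absMoment₂_periodicMajorant (hKA c e))
      (abs_baseKer_le_periodicMajorant hN (hK c e)) (hcol' c e) μ'
  exact rowDefect_eq_zero n hcol hrow hT1 μ ν

omit [NeZero n] in
/-- [folklore] **THE JUNCTION WITH A DEFECT**: a piece whose (1.22)-moment is `n⁻⁸·avgM2 n Q μ ν + D` with absolutely second-moment-summable base-point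
kernels has its (1.22)-moment EQUAL to the uniform base-point average of the punctured full sums of `w ↦ n⁻⁸·w_μw_ν·baseKer Q b w`, PLUS `D`
(`AssemblySlots.secondMoment_eq_avg_fullSum` is the case `D = 0`). -/
theorem secondMoment_eq_avg_fullSum_add {P : B12Beta.Kernel 4} {Q : Ker₂ 4} {μ ν : Fin 4} {D : ℝ}
    (hP : ∑' z : Site 4, P μ ν z * (z μ : ℝ) * (z ν : ℝ) = ((n : ℝ) ^ 8)⁻¹ * avgM2 n Q μ ν + D)
    (hQ : ∀ r : Fin 4 → Fin n, AbsMoment₂ (baseKer Q (resSite r))) :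
    B12Beta.secondMoment P μ ν =
      (∑ b ∈ (univ : Finset (Fin 4 → Fin n)).image resSite, ((n : ℝ) ^ 4)⁻¹ *
        fullSum (fun w : Pt => ((n : ℝ) ^ 8)⁻¹ * (toReal w μ * toReal w ν * baseKer Q b w))) + D := by
  rw [B12Beta.secondMoment, hP, avgM2_eq_sum_fullSum Q hQ μ ν, sum_image_resSite, mul_sum, add_left_inj]
  refine sum_congr rfl fun r _ => ?_
  rw [WindowIdentification.fullSum_const_mul _ (exists_tendsto_psum_weight_mul (hQ r) μ ν)]
  ring

end Defect

/-! ## §2 Slot (F) with the defect, over any leg -/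

section Leg

variable {F : Type*} [Fintype F] [Nonempty F]
variable (n : ℕ) [NeZero n] (A : MKer 4 F) {S : Fin 4 → Site 4 → MKer 4 F} {Wf : Fin 4 → Site 4 → Fin 4 → Site 4 → MKer 4 F}
  {Cs C2 δ : ℝ}

/-- [folklore] **A4 OVER ANY LEG WITH THE DEFECT DISPLAYED — NO WARD ROWS, NO PARITY, NO TABLE SYMMETRY.**  Leg `A` spread and block covariant; `S`
self-localised and fine-translation covariant; `Wf` bi-localised at its two fine bonds and jointly covariant — NOTHING ELSE.  Then the coarse BOND
second moment `Σ'_z z_κ z_λ · n⁸ · TOfLeg n A S (tableRedF n Wf) μ ν z` EQUALS `avgM2 n (fineHessA A S Wf μ ν) κ λ + crossK n (fineHessA A S Wf) κ λ μ ν`. -/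
theorem bondSecondMoment_TOfLeg_eq_avgM2_add_crossK (hA : Spr A) (hAcov : ∀ t : Site 4, shiftK (-((n : ℤ) • t)) A = A)
    (hS : ∀ κ' u, BiLoc (S κ' u) u u Cs δ) (hW : ∀ κ' u l' u', BiLoc (Wf κ' u l' u') u u' C2 δ) (hδ : 0 < δ)
    (hScov : ∀ (κ' : Fin 4) (u v : Site 4), S κ' (u + v) = shiftK (-v) (S κ' u))
    (hWcov : ∀ (κ' : Fin 4) (u : Site 4) (l' : Fin 4) (u' v : Site 4), Wf κ' (u + v) l' (u' + v) = shiftK (-v) (Wf κ' u l' u'))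
    (κ lam μ ν : Fin 4) :
    ∑' z : Site 4, ((z κ * z lam : ℤ) : ℝ) * ((n : ℝ) ^ 8 * TOfLeg n A S (tableRedF n Wf) μ ν z)
      = avgM2 n (fineHessA A S Wf μ ν) κ lam + crossK n (fineHessA A S Wf) κ lam μ ν := by
  have h := bondSecondMomentP_solutionOp_four_cross n (fineHessA A S Wf) (isBlockPeriodic_fineHessA n A hAcov hScov hWcov)
    (absMoment₂_baseKer_fineHessA A hA hS hW hδ) κ lam μ ν
  rw [← h, ← (Equiv.neg (Site 4)).tsum_eq]
  refine tsum_congr fun z => ?_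
  rw [TOfLeg_tableRedF_eq_dressedEntryP n A hA hAcov hS hW hδ hScov hWcov μ ν]
  simp only [Equiv.neg_apply, Pi.neg_apply, neg_mul_neg, neg_neg]

/-- [folklore] The same in `B12Beta.secondMoment` currency: `Σ'_z TOfLeg … μ ν z · z_κ · z_λ = n⁻⁸·avgM2 n (fineHessA μ ν) κ λ + n⁻⁸·crossK n (fineHessA) κ λ μ ν`. -/
theorem secondMoment_TOfLeg_eq_add (hA : Spr A) (hAcov : ∀ t : Site 4, shiftK (-((n : ℤ) • t)) A = A)
    (hS : ∀ κ' u, BiLoc (S κ' u) u u Cs δ) (hW : ∀ κ' u l' u', BiLoc (Wf κ' u l' u') u u' C2 δ) (hδ : 0 < δ)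
    (hScov : ∀ (κ' : Fin 4) (u v : Site 4), S κ' (u + v) = shiftK (-v) (S κ' u))
    (hWcov : ∀ (κ' : Fin 4) (u : Site 4) (l' : Fin 4) (u' v : Site 4), Wf κ' (u + v) l' (u' + v) = shiftK (-v) (Wf κ' u l' u'))
    (κ lam μ ν : Fin 4) :
    ∑' z : Site 4, TOfLeg n A S (tableRedF n Wf) μ ν z * (z κ : ℝ) * (z lam : ℝ)
      = ((n : ℝ) ^ 8)⁻¹ * avgM2 n (fineHessA A S Wf μ ν) κ lam + ((n : ℝ) ^ 8)⁻¹ * crossK n (fineHessA A S Wf) κ lam μ ν := by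
  have hn' : (n : ℝ) ^ 8 ≠ 0 := pow_ne_zero 8 (by exact_mod_cast NeZero.ne n)
  have h := bondSecondMoment_TOfLeg_eq_avgM2_add_crossK n A hA hAcov hS hW hδ hScov hWcov κ lam μ ν
  have e : (fun z : Site 4 => ((z κ * z lam : ℤ) : ℝ) * ((n : ℝ) ^ 8 * TOfLeg n A S (tableRedF n Wf) μ ν z))
      = fun z => (n : ℝ) ^ 8 * (TOfLeg n A S (tableRedF n Wf) μ ν z * (z κ : ℝ) * (z lam : ℝ)) := by
    funext z
    push_cast
    ring
  rw [e, tsum_mul_left] at h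
  calc ∑' z : Site 4, TOfLeg n A S (tableRedF n Wf) μ ν z * (z κ : ℝ) * (z lam : ℝ)
      = ((n : ℝ) ^ 8)⁻¹ * ((n : ℝ) ^ 8 * ∑' z : Site 4, TOfLeg n A S (tableRedF n Wf) μ ν z * (z κ : ℝ) * (z lam : ℝ)) := by
        rw [← mul_assoc, inv_mul_cancel₀ hn', one_mul]
    _ = _ := by rw [h, mul_add]

/-- [folklore] **(K7) «TRANSFER-Δ»: SLOT (F) OVER ANY LEG WITHOUT `hrow`** — the (1.22)-moment of the `ℋ`-dressed one-shot kernel of the piece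
`(A, S, Wf)` IS the uniform base-point average over `[0,n)⁴` of the punctured full sums of `w ↦ n⁻⁸·w_μw_ν·baseKer (fineHessA A S Wf μ ν) b w`
PLUS THE EXPLICIT ROW DEFECT `rowDefect n (fineHessA A S Wf) μ ν`.  Hypotheses: the leg binder `Spr A` + block covariance and the localisation ∕
covariance sockets of `S`, `Wf` ONLY.  The record's `AssemblySlots.hF_TOfRed` ∕ `hF_PghQ_of_wardRows` are the case `rowDefect = 0` (§4, `rowDefect_eq_zero`). -/
theorem secondMoment_TOfLeg_eq_avg_fullSum_add_rowDefect (hA : Spr A) (hAcov : ∀ t : Site 4, shiftK (-((n : ℤ) • t)) A = A)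
    (hS : ∀ κ' u, BiLoc (S κ' u) u u Cs δ) (hW : ∀ κ' u l' u', BiLoc (Wf κ' u l' u') u u' C2 δ) (hδ : 0 < δ)
    (hScov : ∀ (κ' : Fin 4) (u v : Site 4), S κ' (u + v) = shiftK (-v) (S κ' u))
    (hWcov : ∀ (κ' : Fin 4) (u : Site 4) (l' : Fin 4) (u' v : Site 4), Wf κ' (u + v) l' (u' + v) = shiftK (-v) (Wf κ' u l' u'))
    (μ ν : Fin 4) :
    B12Beta.secondMoment (TOfLeg n A S (tableRedF n Wf)) μ ν =
      (∑ b ∈ (univ : Finset (Fin 4 → Fin n)).image resSite, ((n : ℝ) ^ 4)⁻¹ *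
        fullSum (fun w : Pt => ((n : ℝ) ^ 8)⁻¹ * (toReal w μ * toReal w ν * baseKer (fineHessA A S Wf μ ν) b w)))
      + rowDefect n (fineHessA A S Wf) μ ν :=
  secondMoment_eq_avg_fullSum_add n (secondMoment_TOfLeg_eq_add n A hA hAcov hS hW hδ hScov hWcov μ ν μ ν)
    fun r => absMoment₂_baseKer_fineHessA A hA hS hW hδ μ ν (resSite r)

end Leg

/-! ## §3 The ghost leg `Ggh n a` -/

section Ghost

variable (n : ℕ) [NeZero n] (a : ℝ) {S : Fin 4 → Site 4 → MKer 4 Unit} {Wf : Fin 4 → Site 4 → Fin 4 → Site 4 → MKer 4 Unit}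
  {Cs C2 δ : ℝ}

/-- [folklore] **(K7) FOR A GHOST-LEG PIECE** (`0 < a`; e.g. the half-covariant tower of the re-cut END, whose half words have NO vanishing rows):
`secondMoment (TOfGh n a S (tableRedF n Wf)) μ ν = Σ_b n⁻⁴·fullSum (…baseKer (fineHessA (Ggh n a) S Wf μ ν) b …) + rowDefect n (fineHessA (Ggh n a) S Wf) μ ν`,
the leg binders discharged by the typer's `spr_Ggh` ∕ `shiftK_Ggh_neg`. -/
theorem secondMoment_TOfGh_eq_avg_fullSum_add_rowDefect (ha : 0 < a) (hS : ∀ κ' u, BiLoc (S κ' u) u u Cs δ)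
    (hW : ∀ κ' u l' u', BiLoc (Wf κ' u l' u') u u' C2 δ) (hδ : 0 < δ)
    (hScov : ∀ (κ' : Fin 4) (u v : Site 4), S κ' (u + v) = shiftK (-v) (S κ' u))
    (hWcov : ∀ (κ' : Fin 4) (u : Site 4) (l' : Fin 4) (u' v : Site 4), Wf κ' (u + v) l' (u' + v) = shiftK (-v) (Wf κ' u l' u'))
    (μ ν : Fin 4) :
    B12Beta.secondMoment (TOfGh n a S (tableRedF n Wf)) μ ν =
      (∑ b ∈ (univ : Finset (Fin 4 → Fin n)).image resSite, ((n : ℝ) ^ 4)⁻¹ *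
        fullSum (fun w : Pt => ((n : ℝ) ^ 8)⁻¹ * (toReal w μ * toReal w ν * baseKer (fineHessA (Ggh n a) S Wf μ ν) b w)))
      + rowDefect n (fineHessA (Ggh n a) S Wf) μ ν :=
  secondMoment_TOfLeg_eq_avg_fullSum_add_rowDefect n (Ggh n a) (spr_Ggh n a ha) (shiftK_Ggh_neg n a ha) hS hW hδ hScov hWcov μ ν

end Ghost

/-! ## §4 Consistency with the record -/

section Record

variable {F : Type*} [Fintype F] [Nonempty F]
variable (n : ℕ) [NeZero n] (A : MKer 4 F) {S : Fin 4 → Site 4 → MKer 4 F} {Wf : Fin 4 → Site 4 → Fin 4 → Site 4 → MKer 4 F}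
  {Cs C2 δ : ℝ}

/-- [folklore] CONSISTENCY (an `example`, not a declaration — the statement IS the landed
`ReducedKernelSandwichLeg.bondSecondMoment_TOfLeg_eq_avgM2`, VERBATIM: symmetric table, Ward rows `hrow`, base-point-summed first moments `hT1`):
the record's A4-leg END is §2 with a vanishing defect — columns from rows by `fineHessA_transpose`, then `crossK_eq_zero`. -/
example (hA : Spr A) (hAcov : ∀ t : Site 4, shiftK (-((n : ℤ) • t)) A = A)
    (hS : ∀ κ' u, BiLoc (S κ' u) u u Cs δ) (hW : ∀ κ' u l' u', BiLoc (Wf κ' u l' u') u u' C2 δ) (hδ : 0 < δ)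
    (hScov : ∀ (κ' : Fin 4) (u v : Site 4), S κ' (u + v) = shiftK (-v) (S κ' u))
    (hWcov : ∀ (κ' : Fin 4) (u : Site 4) (l' : Fin 4) (u' v : Site 4), Wf κ' (u + v) l' (u' + v) = shiftK (-v) (Wf κ' u l' u'))
    (hWsymm : ∀ (κ' : Fin 4) (u : Site 4) (l' : Fin 4) (u' : Site 4), Wf κ' u l' u' = Wf l' u' κ' u)
    (hrow : ∀ (κ' l' : Fin 4) (b : Site 4), HasSum (fineHessA A S Wf κ' l' b) 0)
    (hT1 : ∀ (κ' l' μ' : Fin 4), ∑ r : Fin 4 → Fin n, ∑' t, (t μ' : ℝ) * baseKer (fineHessA A S Wf κ' l') (resSite r) t = 0)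
    (κ lam μ ν : Fin 4) :
    ∑' z : Site 4, ((z κ * z lam : ℤ) : ℝ) * ((n : ℝ) ^ 8 * TOfLeg n A S (tableRedF n Wf) μ ν z)
      = avgM2 n (fineHessA A S Wf μ ν) κ lam := by
  have hcol : ∀ (κ' l' : Fin 4) (b : Site 4), HasSum (fun s => fineHessA A S Wf κ' l' s b) 0 := fun κ' l' b =>
    (hrow l' κ' b).congr_fun fun s => fineHessA_transpose A hA hS hδ hWsymm κ' l' s b
  rw [bondSecondMoment_TOfLeg_eq_avgM2_add_crossK n A hA hAcov hS hW hδ hScov hWcov, crossK_eq_zero n hcol hrow hT1, add_zero]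

end Record

end Summit.QuantumFields.BalabanUV.Beta.D1BFx.MomentTransferDefect
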